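import Literature.MeasureTheory.Group.InvariantQuotientProdNormalized
import Literature.MeasureTheory.Group.InvariantQuotientOrbitalProd
import HarnessLib

/-!
# Orbital integrals of product functions factor EXACTLY for quotients of product Haar measures:
# `∫_{G/C(γ)} Φ(yγy⁻¹) d(ν/ρ) = (∫_{G₁/C(γ₁)} ξ d(ν₁/ρ₁)) (∫_{G₂/C(γ₂)} Θ d(ν₂/ρ₂))`
(Gelbart, *Automorphic forms on adele groups* (1975), §10, p. 155, (10.19), with its equality sign;
Folland (1995), Thm. 2.49 / (2.52))

Topic `MeasureTheory/Group`; namespace `Literature.MeasureTheory.Group`; theorems only (no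
definition, no named fact, no instance visible to importers). `InvariantQuotientOrbitalProd` proves
the factorisation of orbital integrals along `e : G₁ × G₂ ≃* G` for ARBITRARY invariant measures on
the three coset spaces, up to one unspecified constant `c ≠ 0`. Here the measures are the canonical
quotient measures `ν/ρ = quotientMeasure` (`InvariantQuotientExistence`) of Haar measures which
correspond under `e` — `ν = e_*(ν₁ ⊗ ν₂)` on `G` and `ρ = e_*(ρ₁ ⊗ ρ₂)` on `C(γ) = e(C(γ₁) × C(γ₂))` —
and the constant is `1`:

* `integral_quotientMeasure_centralizer_eq_integral_prod` — transport + Fubini: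
  `∫_{G/C(γ)} F d(ν/ρ) = ∫_{(G₁/C(γ₁)) × (G₂/C(γ₂))} F(e(a, k) C(γ)) d((ν₁/ρ₁) ⊗ (ν₂/ρ₂))`
  (`map_cosetCongr_quotientMeasure` of `InvariantQuotientTransport` and
  `map_quotientProdHomeomorph_symm_prod_quotientMeasure_eq` of `InvariantQuotientProdNormalized`);
* `lintegral_quotientMeasure_centralizer_eq_lintegral_lintegral`, `lintegral_descConj_quotientMeasure_eq_mul`
  — the same in `[0, ∞]`-valued form for measurable data (the shape of the orbital integrals in the
  class-term comparison `quaternion_glTwo_classTerm_eq`);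
* `integral_descConj_quotientMeasure_eq_mul` — **(10.19) with equality**: for every
  `Φ(e(a, k)) = ξ(a) Θ(k)`,
  `∫_{G/C(γ)} Φ(y γ y⁻¹) d(ν/ρ)(y) = (∫_{G₁/C(γ₁)} ξ(a γ₁ a⁻¹) d(ν₁/ρ₁)) (∫_{G₂/C(γ₂)} Θ(k γ₂ k⁻¹) d(ν₂/ρ₂))`.

With `e` the place splittings (`GLn.placeSplitting`, `Quat.placeSplitting`, and their `S`-versions)
and product Haar measures on `G_𝔸 = G_S × G^S`, `B_𝔸 = B_S × B^S`, this is the printed (10.19).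
Part of the inline (D-0026) decomposition of
`Literature.NumberTheory.Automorphic.strong_multiplicity_one_quaternionUnits`.

## References

* S. Gelbart, *Automorphic forms on adele groups*, Ann. of Math. Studies 83 (1975), §10, p. 155,
  (10.19) [Gelbart1975].
* G. B. Folland, *A Course in Abstract Harmonic Analysis* (1995), §2.6, Thm. 2.49, (2.52) [Folland1995].
-/

noncomputable section

open MeasureTheory MeasureTheory.Measure Topology
open scoped NNReal ENNReal

namespace Literature.MeasureTheory.Group

section OrbitalNormalized

variable {G₁ G₂ G : Type*} [Group G₁] [Group G₂] [Group G]
  [TopologicalSpace G₁] [TopologicalSpace G₂] [TopologicalSpace G]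
  [IsTopologicalGroup G₁] [IsTopologicalGroup G₂] [IsTopologicalGroup G]
  [LocallyCompactSpace G₁] [LocallyCompactSpace G₂] [LocallyCompactSpace G]
  [SecondCountableTopology G₁] [SecondCountableTopology G₂] [SecondCountableTopology G]
  [T2Space G₁] [T2Space G₂] [T2Space G]
  [MeasurableSpace G₁] [BorelSpace G₁] [MeasurableSpace G₂] [BorelSpace G₂] [MeasurableSpace G] [BorelSpace G]
  (e : G₁ × G₂ ≃* G) (he : Continuous e) (hes : Continuous e.symm) {γ : G} {γ₁ : G₁} {γ₂ : G₂}
  (hγ : e (γ₁, γ₂) = γ)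
  (hC : IsClosed ((Subgroup.centralizer ({γ} : Set G) : Subgroup G) : Set G))
  (hC₁ : IsClosed ((Subgroup.centralizer ({γ₁} : Set G₁) : Subgroup G₁) : Set G₁))
  (hC₂ : IsClosed ((Subgroup.centralizer ({γ₂} : Set G₂) : Subgroup G₂) : Set G₂))
  [MeasurableSpace (G ⧸ Subgroup.centralizer ({γ} : Set G))] [BorelSpace (G ⧸ Subgroup.centralizer ({γ} : Set G))]
  [MeasurableSpace (G₁ ⧸ Subgroup.centralizer ({γ₁} : Set G₁))] [BorelSpace (G₁ ⧸ Subgroup.centralizer ({γ₁} : Set G₁))]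
  [MeasurableSpace (G₂ ⧸ Subgroup.centralizer ({γ₂} : Set G₂))] [BorelSpace (G₂ ⧸ Subgroup.centralizer ({γ₂} : Set G₂))]
  (ρ₁ : Measure (Subgroup.centralizer ({γ₁} : Set G₁))) [ρ₁.IsMulLeftInvariant] [IsFiniteMeasureOnCompacts ρ₁]
  [ρ₁.IsOpenPosMeasure] [ρ₁.IsInvInvariant] [SFinite ρ₁]
  (ρ₂ : Measure (Subgroup.centralizer ({γ₂} : Set G₂))) [ρ₂.IsMulLeftInvariant] [IsFiniteMeasureOnCompacts ρ₂]
  [ρ₂.IsOpenPosMeasure] [ρ₂.IsInvInvariant] [SFinite ρ₂]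
  (ρp : Measure ((Subgroup.centralizer ({γ₁} : Set G₁)).prod (Subgroup.centralizer ({γ₂} : Set G₂))))
  [ρp.IsMulLeftInvariant] [IsFiniteMeasureOnCompacts ρp] [ρp.IsOpenPosMeasure] [ρp.IsInvInvariant] [SFinite ρp]
  (hρp : Measure.map (Subgroup.prodEquiv (Subgroup.centralizer ({γ₁} : Set G₁)) (Subgroup.centralizer ({γ₂} : Set G₂))) ρp =
    ρ₁.prod ρ₂)
  (ρ : Measure (Subgroup.centralizer ({γ} : Set G))) [ρ.IsMulLeftInvariant] [IsFiniteMeasureOnCompacts ρ]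
  [ρ.IsOpenPosMeasure] [ρ.IsInvInvariant] [SFinite ρ]
  (hρ : ρ = Measure.map (subgroupCongrHomeomorph e _ (Subgroup.centralizer ({γ} : Set G))
    (forall_apply_mem_centralizer_iff e hγ) he hes) ρp)
  (ν₁ : Measure G₁) [IsHaarMeasure ν₁] [ν₁.IsMulRightInvariant]
  (ν₂ : Measure G₂) [IsHaarMeasure ν₂] [ν₂.IsMulRightInvariant]
  (ν : Measure G) [IsHaarMeasure ν] [ν.IsMulRightInvariant] (hν : ν = Measure.map e (ν₁.prod ν₂))

include hes hC₁ hC₂ hρp hρ hν in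
/-- **Transport + Fubini for canonical quotient measures**: with `e : G₁ × G₂ ≃* G`, `γ = e(γ₁, γ₂)`,
product Haar measures `ν = e_*(ν₁ ⊗ ν₂)` and `ρ = e_*(ρ₁ ⊗ ρ₂)` on `C(γ) = e(C(γ₁) × C(γ₂))`, for every
Banach-valued `F` on `G ⧸ C(γ)`:
`∫ F d(ν/ρ) = ∫_{(G₁/C(γ₁)) × (G₂/C(γ₂))} F(e(a, k) C(γ)) d((ν₁/ρ₁) ⊗ (ν₂/ρ₂))(aC(γ₁), kC(γ₂))`.
[cite: Folland1995, §2.6 Thm. 2.49, (2.52)] -/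
theorem integral_quotientMeasure_centralizer_eq_integral_prod {E : Type*} [NormedAddCommGroup E] [NormedSpace ℝ E]
    (F : G ⧸ Subgroup.centralizer ({γ} : Set G) → E) :
    ∫ y, F y ∂quotientMeasure (Subgroup.centralizer ({γ} : Set G)) ρ hC ν =
      ∫ p, F (cosetCongr e _ _ (forall_apply_mem_centralizer_iff e hγ)
          ((QuotientGroup.prodEquiv (Subgroup.centralizer ({γ₁} : Set G₁)) (Subgroup.centralizer ({γ₂} : Set G₂))).symm p))
        ∂(quotientMeasure _ ρ₁ hC₁ ν₁).prod (quotientMeasure _ ρ₂ hC₂ ν₂) := by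
  -- Borel structure on the intermediate coset space and closedness instances
  letI : MeasurableSpace ((G₁ × G₂) ⧸ (Subgroup.centralizer ({γ₁} : Set G₁)).prod (Subgroup.centralizer ({γ₂} : Set G₂))) :=
    borel _
  haveI : BorelSpace ((G₁ × G₂) ⧸ (Subgroup.centralizer ({γ₁} : Set G₁)).prod (Subgroup.centralizer ({γ₂} : Set G₂))) := ⟨rfl⟩
  haveI hCp : IsClosed (((Subgroup.centralizer ({γ₁} : Set G₁)).prod (Subgroup.centralizer ({γ₂} : Set G₂)) :
      Subgroup (G₁ × G₂)) : Set (G₁ × G₂)) := isClosed_coe_prod _ _ hC₁ hC₂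
  haveI : IsClosed ((Subgroup.centralizer ({γ} : Set G) : Subgroup G) : Set G) := hC
  haveI : IsClosed ((Subgroup.centralizer ({γ₁} : Set G₁) : Subgroup G₁) : Set G₁) := hC₁
  haveI : IsClosed ((Subgroup.centralizer ({γ₂} : Set G₂) : Subgroup G₂) : Set G₂) := hC₂
  -- transport along `cosetCongr e`
  have htr := map_cosetCongr_quotientMeasure e he hes _ (Subgroup.centralizer ({γ} : Set G))
    (forall_apply_mem_centralizer_iff e hγ) ρp ρ (ν₁.prod ν₂) ν hρ hν
  set ψ := cosetCongrHomeomorph e _ (Subgroup.centralizer ({γ} : Set G)) (forall_apply_mem_centralizer_iff e hγ) he hes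
    with hψ
  have hψc : (cosetCongr e _ _ (forall_apply_mem_centralizer_iff e hγ) :
      (G₁ × G₂) ⧸ (Subgroup.centralizer ({γ₁} : Set G₁)).prod (Subgroup.centralizer ({γ₂} : Set G₂)) →
        G ⧸ Subgroup.centralizer ({γ} : Set G)) = ψ := rfl
  have h1 : ∫ y, F y ∂quotientMeasure (Subgroup.centralizer ({γ} : Set G)) ρ hC ν =
      ∫ z, F (ψ z) ∂quotientMeasure _ ρp hCp (ν₁.prod ν₂) := by
    rw [← htr, hψc, ← Homeomorph.toMeasurableEquiv_coe ψ, integral_map_equiv]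
  rw [h1, integral_quotientMeasure_prod_eq_integral_prod _ _ ρ₁ ρ₂ ρp hρp ν₁ ν₂]
  rfl

include hes hC₁ hC₂ hρp hρ hν in
/-- **Gelbart's (10.19) with its equality sign.** For a bicontinuous `e : G₁ × G₂ ≃* G`,
`γ = e(γ₁, γ₂)` with closed centralisers, Haar measures `ν_i` on `G_i`, `ρ_i` on `C(γ_i)` and their
images `ν = e_*(ν₁ ⊗ ν₂)` on `G`, `ρ = e_*(ρ₁ ⊗ ρ₂)` on `C(γ) = e(C(γ₁) × C(γ₂))`, the orbital integral
of every product function `Φ(e(a, k)) = ξ(a) Θ(k)` against the quotient measure `ν/ρ` is EXACTLY the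
product of the orbital integrals of the factors against `ν₁/ρ₁` and `ν₂/ρ₂`:
`∫_{G/C(γ)} Φ(y γ y⁻¹) d(ν/ρ)(y) = (∫_{G₁/C(γ₁)} ξ(a γ₁ a⁻¹) d(ν₁/ρ₁)(a)) (∫_{G₂/C(γ₂)} Θ(k γ₂ k⁻¹) d(ν₂/ρ₂)(k))`
("`∫_{B_𝔸 \ G_𝔸} Φ(x⁻¹ γ x) dx` is equal to the product of `∫_{B_v \ G_v} f_v(x_v⁻¹ γ x_v) dx_v` and
[the integral away from `v`]", for product measures on `G_𝔸 = G_v × G^{(v)}`, `B_𝔸 = B_v × B^{(v)}`).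
[cite: Gelbart1975, p. 155 (10.19)] [cite: Folland1995, §2.6 (2.52)] -/
theorem integral_descConj_quotientMeasure_eq_mul (Φ : G → ℂ) (ξ : G₁ → ℂ) (Θ : G₂ → ℂ)
    (hΦ : ∀ a k, Φ (e (a, k)) = ξ a * Θ k) :
    ∫ y, descConj γ (Subgroup.centralizer ({γ} : Set G)) (centralizer_comm γ) Φ y
        ∂quotientMeasure (Subgroup.centralizer ({γ} : Set G)) ρ hC ν =
      (∫ x, descConj γ₁ _ (centralizer_comm _) ξ x ∂quotientMeasure _ ρ₁ hC₁ ν₁) *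
        ∫ x, descConj γ₂ _ (centralizer_comm _) Θ x ∂quotientMeasure _ ρ₂ hC₂ ν₂ := by
  rw [integral_quotientMeasure_centralizer_eq_integral_prod e he hes hγ hC hC₁ hC₂ ρ₁ ρ₂ ρp hρp ρ hρ ν₁ ν₂ ν hν,
    integral_prod_mul (μ := quotientMeasure _ ρ₁ hC₁ ν₁) (ν := quotientMeasure _ ρ₂ hC₂ ν₂)
      (descConj γ₁ _ (centralizer_comm _) ξ) (descConj γ₂ _ (centralizer_comm _) Θ) |>.symm]
  congr 1
  funext p
  obtain ⟨x₁, x₂⟩ := p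
  exact descConj_cosetCongr_prodEquiv_symm e hγ Φ ξ Θ hΦ x₁ x₂

include hes hC₁ hC₂ hρp hρ hν in
/-- **Transport + Tonelli for canonical quotient measures, `[0, ∞]`-valued form**: for measurable
`F ≥ 0` on `G ⧸ C(γ)`,
`∫⁻ F d(ν/ρ) = ∫⁻_{G₁/C(γ₁)} ∫⁻_{G₂/C(γ₂)} F(e(a, k) C(γ)) d(ν₂/ρ₂) d(ν₁/ρ₁)`.
[cite: Folland1995, §2.6 Thm. 2.49, (2.52)] -/
theorem lintegral_quotientMeasure_centralizer_eq_lintegral_lintegral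
    {F : G ⧸ Subgroup.centralizer ({γ} : Set G) → ℝ≥0∞} (hF : Measurable F) :
    ∫⁻ y, F y ∂quotientMeasure (Subgroup.centralizer ({γ} : Set G)) ρ hC ν =
      ∫⁻ x₁, ∫⁻ x₂, F (cosetCongr e _ _ (forall_apply_mem_centralizer_iff e hγ)
          ((QuotientGroup.prodEquiv (Subgroup.centralizer ({γ₁} : Set G₁)) (Subgroup.centralizer ({γ₂} : Set G₂))).symm (x₁, x₂)))
        ∂quotientMeasure _ ρ₂ hC₂ ν₂ ∂quotientMeasure _ ρ₁ hC₁ ν₁ := by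
  letI : MeasurableSpace ((G₁ × G₂) ⧸ (Subgroup.centralizer ({γ₁} : Set G₁)).prod (Subgroup.centralizer ({γ₂} : Set G₂))) :=
    borel _
  haveI : BorelSpace ((G₁ × G₂) ⧸ (Subgroup.centralizer ({γ₁} : Set G₁)).prod (Subgroup.centralizer ({γ₂} : Set G₂))) := ⟨rfl⟩
  haveI hCp : IsClosed (((Subgroup.centralizer ({γ₁} : Set G₁)).prod (Subgroup.centralizer ({γ₂} : Set G₂)) :
      Subgroup (G₁ × G₂)) : Set (G₁ × G₂)) := isClosed_coe_prod _ _ hC₁ hC₂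
  haveI : IsClosed ((Subgroup.centralizer ({γ} : Set G) : Subgroup G) : Set G) := hC
  haveI : IsClosed ((Subgroup.centralizer ({γ₁} : Set G₁) : Subgroup G₁) : Set G₁) := hC₁
  haveI : IsClosed ((Subgroup.centralizer ({γ₂} : Set G₂) : Subgroup G₂) : Set G₂) := hC₂
  rw [lintegral_quotientMeasure_eq_of_mulEquiv e he hes _ (Subgroup.centralizer ({γ} : Set G))
      (forall_apply_mem_centralizer_iff e hγ) ρp ρ (ν₁.prod ν₂) ν hρ hν F]
  exact lintegral_quotientMeasure_prod_eq_lintegral_lintegral _ _ ρ₁ ρ₂ ρp hρp ν₁ ν₂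
    (F := fun x => F (cosetCongr e _ _ (forall_apply_mem_centralizer_iff e hγ) x))
    (hF.comp (continuous_cosetCongr e _ _ (forall_apply_mem_centralizer_iff e hγ) he).measurable)

include hes hC₁ hC₂ hρp hρ hν in
/-- **Gelbart's (10.19) with its equality sign, `[0, ∞]`-valued form** (absolute-convergence
bookkeeping): for measurable `Φ, ξ, Θ ≥ 0` with `Φ(e(a, k)) = ξ(a) Θ(k)`,
`∫⁻_{G/C(γ)} Φ(y γ y⁻¹) d(ν/ρ) = (∫⁻_{G₁/C(γ₁)} ξ(a γ₁ a⁻¹) d(ν₁/ρ₁)) (∫⁻_{G₂/C(γ₂)} Θ(k γ₂ k⁻¹) d(ν₂/ρ₂))`.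
[cite: Gelbart1975, p. 155 (10.19)] [cite: Folland1995, §2.6 (2.52)] -/
theorem lintegral_descConj_quotientMeasure_eq_mul
    {Φ : G → ℝ≥0∞} {ξ : G₁ → ℝ≥0∞} {Θ : G₂ → ℝ≥0∞} (hΦ : Measurable Φ) (hξ : Measurable ξ) (hΘ : Measurable Θ)
    (hΦe : ∀ a k, Φ (e (a, k)) = ξ a * Θ k) :
    ∫⁻ y, descConj γ (Subgroup.centralizer ({γ} : Set G)) (centralizer_comm γ) Φ y
        ∂quotientMeasure (Subgroup.centralizer ({γ} : Set G)) ρ hC ν =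
      (∫⁻ x, descConj γ₁ _ (centralizer_comm _) ξ x ∂quotientMeasure _ ρ₁ hC₁ ν₁) *
        ∫⁻ x, descConj γ₂ _ (centralizer_comm _) Θ x ∂quotientMeasure _ ρ₂ hC₂ ν₂ := by
  rw [lintegral_quotientMeasure_centralizer_eq_lintegral_lintegral e he hes hγ hC hC₁ hC₂ ρ₁ ρ₂ ρp hρp ρ hρ ν₁ ν₂ ν hν
      (measurable_descConj γ _ (centralizer_comm γ) hΦ)]
  have h1 : ∀ x₁ x₂, descConj γ (Subgroup.centralizer ({γ} : Set G)) (centralizer_comm γ) Φ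
      (cosetCongr e _ _ (forall_apply_mem_centralizer_iff e hγ)
        ((QuotientGroup.prodEquiv (Subgroup.centralizer ({γ₁} : Set G₁)) (Subgroup.centralizer ({γ₂} : Set G₂))).symm (x₁, x₂))) =
      descConj γ₁ _ (centralizer_comm _) ξ x₁ * descConj γ₂ _ (centralizer_comm _) Θ x₂ := fun x₁ x₂ =>
    descConj_cosetCongr_prodEquiv_symm e hγ Φ ξ Θ hΦe x₁ x₂
  simp_rw [h1]
  exact lintegral_lintegral_mul (measurable_descConj γ₁ _ (centralizer_comm _) hξ).aemeasurable
    (measurable_descConj γ₂ _ (centralizer_comm _) hΘ).aemeasurable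

end OrbitalNormalized

end Literature.MeasureTheory.Group
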